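import Summits.QuantumFields.BalabanUV.Beta.EriceRemainderEnclosureHistoryAutonomyComparisonGapPersistence
import Summits.QuantumFields.BalabanUV.Beta.EriceRemainderEnclosureHistoryAutonomyComparisonSlackSystem
import Summits.QuantumFields.BalabanUV.Beta.EriceRemainderEnclosureHistoryAutonomyComparisonTowerUniform

/-!
# EriceRemainderEnclosureHistoryAutonomyComparisonTowerSlack — (E64c) EVERY TOWER WITH CONSECUTIVE RATIOS `≥ 30` COMPARES AT ANY SIZE, WHATEVER ITS HEIGHT:
# `B(u) = b + L_0·u_0 + Σ_{i<n} L_{a_i}·u_{a_i}` (`b > 0`; ages `a_0 > a_1 > … > a_{n−1} ≥ 1` with **`30·a_{i+1} ≤ a_i`**; the height `n`, the sizes `L_{a_i} ≥ 0`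
# AND the Markov weight `L_0 ≥ 0` ARBITRARY) compares at any size under every isotone excess with a zeroth moment — (E63c) needed ratios
# `36 ∕ 165 ∕ 704 ∕ 2896 ∕ …` growing exponentially with the height; here ONE ratio serves every height.  THE STEP is the «loss × slack» chain: (E64a)'s gap
# persistence turns the deeper drops into a self-consistent load on every age's window, and (E64b) closes the system

Cell `pub-balaban`, β-function sub-cell, BINDER row D4 «RemainderConst leaves for Bałaban's split» (`HOME/BINDER-OWNERS.md`; owner lineage `b2b-balaban-beta-an4`;
this file by co-owner #2 lineage `b2b-balaban-beta-d4-p2`, generation 57), β-FLOW TEAM duty (1), FREEZE (0) honoured (def-free; (E64a)'s `gap_persist` ∕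
`one_sub_two_mul_div_le_sq`, (E64b)'s `sum_le_of_slack_system`, (E63a)'s `le_of_isotone_excess_of_step_below`, (E63c)'s `ratio_le_sqrt_two`, (E58b)'s
`weight_le_profile`, (E49j)'s `excess_shift_le`, (E48a)'s `strictAnti_of_memFlow` ∕ `le_of_pin_le` ∕ `memFlow_tail`, node U2's `invSq_eq_of_memFlow` ∕ `drive` ∕
`mul_lower_le_drive` ∕ `Sharpness.abs_sub_le_half_cube_mul`, (E43)'s `affine_monotone` ∕ `affine_floor` ∕ `affine_zerothMoment` BY NAME; nothing restated).

HONEST FRAMING (page 1, verbatim and binding).  *"Discharging BetaPertH makes Bałaban's UV stability UNCONDITIONAL — a real constructive-QFT result; it is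
NOT the continuum limit and NOT the Clay problem."*  THIS FILE DISCHARGES NOTHING OF THE KIND.  Elementary real analysis about ABSTRACT affine functionals on a
box ]0,γ]^ℕ with displayed supports and signs — hypotheses of a census, not facts; the form, signs, ages and moments of Bałaban's (1.22) limit functional are
NOT PRINTED ([I] p. 298; GAPS G-t4-U2-1∕-2) and NOT asserted.  Row D4 class UNCHANGED (critical-path width 0; instance 0∕1; D4 DISCHARGE NO DATE).  HONEST
DEPENDENCY: continuum YM on T⁴ ⇐ BetaPertH ∧ nine spine estimates (0/9 proved); BetaPertH ⇐ (D1) ∧ (D4) ∧ CAP+tail; G-an2-4 gates asym, D1 and NE2/3/4.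

THE POINT (census sense (α); the COMPARISON column, conjecture (E58′): `h′ ≤ h` for EVERY profile).  By (E61a)'s principle the STEP at a pin `y` may use
comparison from every deeper pin.  With `η = (B′−B)(h′)`, the pin read of age `a_i` is `ρ_i = L_{a_i}(h_{a_i} − h′_{a_i}) ≤ x_i·δ_{a_i}∕a_i`
(`x_i = a_i·L_{a_i}·h_{a_i}³∕2 ≤ √2∕2`, each age separately, by (E58b)+(E63c)), and the level gap is `δ_{a_i} ≤ a_i·η − Σ_{l=1}^{a_i} dd_l` where, by (E64a),
the drop read at scale `l` re-reads every pin read: `dd_l ≥ Σ_{i′} (a_{i′}∕(a_{i′}+l))²·ρ_{i′} ≥ Σ_{i′}(a_{i′}∕(a_{i′}+a_i))²·ρ_{i′}` (`l ≤ a_i`).  Hence THE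
SYSTEM `ρ_i·(1 + x_i∕4) ≤ x_i·(η − Σ_{i′ older}(a_{i′}∕(a_{i′}+a_i))²·ρ_{i′})` (own window `1∕4`; younger ages dropped), with `(a′∕(a′+j))² ≥ 1 − 2j∕a′ ≥
1 − 2·30^{−(i−i′)}` along the tower — and (E64b) closes it: `Σ_i ρ_i ≤ η·(1 − 4^{−n})`.  §1 the separation chain and the injective enumeration; §2 THE STEP
`effective_le_of_family_le_at_tower_slack`; §3 END `le_of_isotone_excess_tower_slack`.  THE PICTURE after (E64): zm alone ⟺ `M·γ ≤ 3√3·b`; one age,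
profile-bounded blocks, fading profiles, uniform windows, all ages within a factor 7, ANY two ages — free (Markov rider); **towers with consecutive ratios
`≥ 30` — free, WHATEVER THE HEIGHT** (was: `(3q(n−1)+4)t ≤ 2(1−q)^n`, i.e. ratio exponential in `n`).  OPEN: ratios in `]7, 30[` for three or more ages;
dense blocks stacked in towers (the same chain applies with a joint load budget per block — next); the numerics (`HOME/…/g57/e64/README.md`) show the
self-consistent bound within 10–20 % of the truth on every profile tested, towers AND dense.  NOT CLAIMED: anything below ratio 30; anything printed.

WHAT IS PROVED ([folklore]; 0 `def`, 0 sorry).  §1 `tower_chain`, `tower_injOn`.  §2 **`effective_le_of_family_le_at_tower_slack`**.  §3 **`le_of_isotone_excess_tower_slack`**.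
-/
noncomputable section
open Finset Set

namespace Summit.QuantumFields.BalabanUV.Beta.EriceRemainderEnclosureHistoryAutonomyComparisonTowerSlack

open Literature.MathematicalPhysics.QuantumFieldTheory.Balaban1983to89
open Literature.MathematicalPhysics.QuantumFieldTheory.Balaban1983to89.T4BetaStationary
open Literature.MathematicalPhysics.QuantumFieldTheory.Balaban1983to89.T4BetaFlowWellPosed
open Literature.MathematicalPhysics.QuantumFieldTheory.Balaban1983to89.T4BetaFlowWellPosed.Sharpness (abs_sub_le_half_cube_mul)
open Summit.QuantumFields.BalabanUV.Beta.EriceRemainderEnclosureHistoryAutonomyOrder (strictAnti_of_memFlow le_of_pin_le memFlow_tail)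
open Summit.QuantumFields.BalabanUV.Beta.EriceRemainderEnclosureHistoryAutonomyComparisonExcess (excess_shift_le)
open Summit.QuantumFields.BalabanUV.Beta.EriceRemainderEnclosureHistoryAutonomyComparisonAffineProfile (weight_le_profile)
open Summit.QuantumFields.BalabanUV.Beta.EriceRemainderEnclosureHistoryAutonomyComparisonTowerUniform (ratio_le_sqrt_two)
open Summit.QuantumFields.BalabanUV.Beta.EriceRemainderEnclosureHistoryAutonomyComparisonDropBound (le_of_isotone_excess_of_step_below)
open Summit.QuantumFields.BalabanUV.Beta.EriceRemainderEnclosureHistoryAutonomyComparisonGapPersistence (gap_persist one_sub_two_mul_div_le_sq)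
open Summit.QuantumFields.BalabanUV.Beta.EriceRemainderEnclosureHistoryAutonomyComparisonSlackSystem (sum_le_of_slack_system)
open Summit.QuantumFields.BalabanUV.Beta.EriceRemainderEnclosureHistoryAutonomyMonotone (affine_monotone affine_floor affine_zerothMoment)

variable {B' : (ℕ → ℝ) → ℝ} {M' γ b y : ℝ} {L : ℕ → ℝ} {K n : ℕ} {a : ℕ → ℕ} {h h' : ℕ → ℝ} {S S' : ℝ → ℕ → ℝ}

/-! ## §1 Towers: the separation chain and the enumeration of the support -/

/-- Along a tower with consecutive ratios `≥ 30` (index `0` the OLDEST age): `30^d·a_{i+d} ≤ a_i`. [folklore] -/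
theorem tower_chain (hsep : ∀ i, i + 1 < n → 30 * a (i + 1) ≤ a i) : ∀ d i, i + d < n → 30 ^ d * a (i + d) ≤ a i
  | 0, i, _ => by simp
  | d + 1, i, hid => by
    have h1 := tower_chain hsep d i (by omega)
    have h2 := hsep (i + d) (by rw [show i + d + 1 = i + (d + 1) by omega]; exact hid)
    rw [show i + (d + 1) = i + d + 1 by omega, pow_succ]
    calc 30 ^ d * 30 * a (i + d + 1) = 30 ^ d * (30 * a (i + d + 1)) := by ring
      _ ≤ 30 ^ d * a (i + d) := Nat.mul_le_mul_left _ h2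
      _ ≤ a i := h1

/-- … hence the ages decrease strictly with the index (`a_{n−1} ≥ 1`), and the enumeration is injective on `[0, n[`. [folklore] -/
theorem tower_injOn (ha1 : ∀ i < n, 1 ≤ a i) (hsep : ∀ i, i + 1 < n → 30 * a (i + 1) ≤ a i) :
    Set.InjOn a (range n : Finset ℕ) := by
  have hlt : ∀ i i', i < i' → i' < n → a i' < a i := by
    intro i i' hii' hi'
    obtain ⟨d, rfl⟩ := Nat.exists_eq_add_of_lt hii'
    have hc := tower_chain hsep (d + 1) i (by omega)
    rw [show i + d + 1 = i + (d + 1) by omega]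
    have hpos := ha1 (i + (d + 1)) hi'
    have h30 : 30 ≤ 30 ^ (d + 1) := by
      calc 30 = 30 ^ 1 := by norm_num
        _ ≤ 30 ^ (d + 1) := Nat.pow_le_pow_right (by norm_num) (by omega)
    calc a (i + (d + 1)) < 30 ^ (d + 1) * a (i + (d + 1)) := by nlinarith
      _ ≤ a i := hc
  intro i hi i' hi' heq
  simp only [coe_range, Set.mem_Iio] at hi hi'
  by_contra hne
  rcases Nat.lt_or_gt_of_ne hne with hlt' | hgt
  · exact absurd heq (hlt i i' hlt' hi').ne'
  · exact absurd heq (hlt i' i hgt hi).ne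

/-! ## §2 THE STEP for a tower with consecutive ratios `≥ 30` -/

/-- **THE STEP FOR A TOWER OF ANY HEIGHT (consecutive ratios `≥ 30`).**  `B(u) = b + Σ_{k<K} L_k·u_k`, `b > 0`, `L ≥ 0` supported on `{0} ∪ {a_0 > a_1 > … >
a_{n−1}}` with `30·a_{i+1} ≤ a_i`, `1 ≤ a_i < K` — the sizes `L_{a_i}` AND the Markov weight `L_0` ARBITRARY, the height `n` ARBITRARY; `B ≤ B′` on the box
with ISOTONE excess; solution families `S`, `S′` (unique box solutions from every pin); a pin `y ∈ ]0,γ]` at which comparison from every DEEPER pin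
`z` (`1∕z² ≥ 1∕y² + b`) is handed: `S′ z ≤ S z`; box solutions `h`, `h′` of `B`, `B′` from `y` with `h′ ≤ h`.  Then `B h ≤ B′ h′`.
THE CHAIN («loss × slack»): with `η = (B′−B)(h′)`, `ρ_i = L_{a_i}·(h_{a_i} − h′_{a_i})` the pin read of age `a_i`, `x_i = a_i·L_{a_i}·h_{a_i}³∕2 ≤ √2∕2`
((E58b) `weight_le_profile`, (E63c) `ratio_le_sqrt_two`): the level gap at `a_i` is at most `a_i·η` MINUS the drops read at the scales `1 … a_i`, each of
which re-reads every pin read `ρ_{i′}` damped by at most `(a_{i′}∕(a_{i′}+a_i))²` ((E64a) `gap_persist`, fed with `U = S(h′_{a_{i′}})`); so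
`ρ_i·(1 + x_i∕4) ≤ x_i·(η − Σ_{i′<i}(a_{i′}∕(a_{i′}+a_i))²·ρ_{i′})`, `(a′∕(a′+j))² ≥ 1 − 2j∕a′ ≥ 1 − 2·30^{−(i−i′)}`, and (E64b) `sum_le_of_slack_system` closes
`Σ_i ρ_i ≤ η`. [folklore] -/
theorem effective_le_of_family_le_at_tower_slack (hL : ∀ k, 0 ≤ L k) (hb : 0 < b)
    (ha1 : ∀ i < n, 1 ≤ a i) (haK : ∀ i < n, a i < K) (hsep : ∀ i, i + 1 < n → 30 * a (i + 1) ≤ a i)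
    (hsupp : ∀ k ∈ range K, k ≠ 0 → (∀ i < n, k ≠ a i) → L k = 0)
    (hexc : ∀ u, SeqBox γ u → (fun u : ℕ → ℝ => b + ∑ k ∈ range K, L k * u k) u ≤ B' u)
    (hDmono : ∀ u v : ℕ → ℝ, SeqBox γ u → SeqBox γ v → (∀ j, u j ≤ v j) →
      B' u - (fun u : ℕ → ℝ => b + ∑ k ∈ range K, L k * u k) u ≤ B' v - (fun u : ℕ → ℝ => b + ∑ k ∈ range K, L k * u k) v)
    (hS : ∀ p, 0 < p → p ≤ γ → SeqBox γ (S p) ∧ MemFlow (fun u : ℕ → ℝ => b + ∑ k ∈ range K, L k * u k) p (S p))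
    (huniq : ∀ p, 0 < p → p ≤ γ → ∀ u u' : ℕ → ℝ, SeqBox γ u → SeqBox γ u' →
      MemFlow (fun u : ℕ → ℝ => b + ∑ k ∈ range K, L k * u k) p u → MemFlow (fun u : ℕ → ℝ => b + ∑ k ∈ range K, L k * u k) p u' → u = u')
    (hS' : ∀ p, 0 < p → p ≤ γ → SeqBox γ (S' p) ∧ MemFlow B' p (S' p))
    (huniq' : ∀ p, 0 < p → p ≤ γ → ∀ u u' : ℕ → ℝ, SeqBox γ u → SeqBox γ u' → MemFlow B' p u → MemFlow B' p u' → u = u')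
    (hy : 0 < y) (_hyγ : y ≤ γ)
    (hdeep : ∀ z, 0 < z → z ≤ γ → 1 / y ^ 2 + b ≤ 1 / z ^ 2 →
      (fun u : ℕ → ℝ => b + ∑ k ∈ range K, L k * u k) (S z) ≤ B' (S' z) ∧ ∀ j, S' z j ≤ S z j)
    (hh : SeqBox γ h) (hf : MemFlow (fun u : ℕ → ℝ => b + ∑ k ∈ range K, L k * u k) y h) (hh' : SeqBox γ h') (hf' : MemFlow B' y h')
    (hle : ∀ j, h' j ≤ h j) : (fun u : ℕ → ℝ => b + ∑ k ∈ range K, L k * u k) h ≤ B' h' := by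
  set B : (ℕ → ℝ) → ℝ := fun u => b + ∑ k ∈ range K, L k * u k with hB_def
  have hmono : ∀ u v : ℕ → ℝ, SeqBox γ u → SeqBox γ v → (∀ j, u j ≤ v j) → B u ≤ B v := affine_monotone hL
  have hlo : ∀ u, SeqBox γ u → b ≤ B u := affine_floor hL
  have hdom : ∀ u, SeqBox γ u → ∑ k ∈ range K, L k * u k ≤ B u := fun u _ => by simp only [hB_def]; linarith
  have hBzm := affine_zerothMoment (γ := γ) (b₀ := b) (K := K) hL
  have hM : 0 ≤ ∑ k ∈ range K, L k := sum_nonneg fun k _ => hL k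
  have hlo' : ∀ u, SeqBox γ u → b ≤ B' u := fun u hu => (hlo u hu).trans (hexc u hu)
  have hanti : Antitone h := (strictAnti_of_memFlow hb hlo hh hf).antitone
  have hanti' : Antitone h' := (strictAnti_of_memFlow hb hlo' hh' hf').antitone
  set η : ℝ := B' h' - B h' with hη_def
  have hη0 : 0 ≤ η := by rw [hη_def]; linarith [hexc h' hh']
  -- gaps g and the drop read at scale m
  have hg0 : ∀ j, 0 ≤ h j - h' j := fun j => sub_nonneg.mpr (hle j)
  have hdd : ∀ m, B (fun j => h (m + j)) - B (fun j => h' (m + j)) = ∑ k ∈ range K, L k * (h (m + k) - h' (m + k)) := by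
    intro m; simp only [hB_def]; rw [add_sub_add_left_eq_sub, ← sum_sub_distrib]; exact sum_congr rfl fun k _ => by ring
  -- (1) the level gap at scale j is at most j·η minus the drops read at scales 1..j
  have hlev : ∀ j : ℕ, 1 / h' j ^ 2 - 1 / h j ^ 2 ≤
      (j : ℝ) * η - ∑ l ∈ range j, ∑ k ∈ range K, L k * (h (l + 1 + k) - h' (l + 1 + k)) := by
    intro j
    rw [invSq_eq_of_memFlow hf j, invSq_eq_of_memFlow hf' j,
      show (1:ℝ) / y ^ 2 + drive B' h' j - (1 / y ^ 2 + drive B h j) = drive B' h' j - drive B h j by ring]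
    unfold drive
    rw [← sum_sub_distrib]
    have hterm : ∀ l ∈ range j, B' (fun i => h' (l + 1 + i)) - B (fun i => h (l + 1 + i)) ≤
        η - ∑ k ∈ range K, L k * (h (l + 1 + k) - h' (l + 1 + k)) := by
      intro l _
      have e1 := (abs_le.mp (excess_shift_le hexc hDmono hh' hanti' l)).1
      have e2 := hdd (l + 1)
      simp only [hB_def] at e1 e2 ⊢
      linarith
    calc ∑ l ∈ range j, (B' (fun i => h' (l + 1 + i)) - B (fun i => h (l + 1 + i)))
        ≤ ∑ l ∈ range j, (η - ∑ k ∈ range K, L k * (h (l + 1 + k) - h' (l + 1 + k))) := sum_le_sum hterm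
      _ = (j : ℝ) * η - ∑ l ∈ range j, ∑ k ∈ range K, L k * (h (l + 1 + k) - h' (l + 1 + k)) := by
          rw [sum_sub_distrib, sum_const, card_range, nsmul_eq_mul]
  -- (2) GAP PERSISTENCE at every age of the tower, through U = S (h′ (a i′))
  have hpers : ∀ i' < n, ∀ l : ℕ, ((a i' : ℝ) / ((a i' : ℝ) + l)) ^ 2 * (h (a i') - h' (a i')) ≤ h (a i' + l) - h' (a i' + l) := by
    intro i' hi' l
    set k' := a i' with hk'_def
    have hk'1 : 1 ≤ k' := ha1 i' hi'
    have hz := (hh' k').1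
    have hzγ := (hh' k').2
    -- the pin h′_{k′} is at least one floor step deeper than y
    have hzdeep : 1 / y ^ 2 + b ≤ 1 / h' k' ^ 2 := by
      rw [invSq_eq_of_memFlow hf' k']
      have := mul_lower_le_drive hlo' hh' k'
      have hk'r : (1 : ℝ) ≤ k' := by exact_mod_cast hk'1
      nlinarith
    obtain ⟨hU, hfU⟩ := hS (h' k') hz hzγ
    have hUle : ∀ i, S (h' k') i ≤ h (k' + i) := fun i =>
      le_of_pin_le (B := B) hb hBzm hM hlo huniq hz (hle k') (hh k').2 hU (seqBox_shift hh k') hfU (memFlow_tail hf k') i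
    have htail : (fun j => h' (k' + j)) = S' (h' k') :=
      huniq' (h' k') hz hzγ _ _ (seqBox_shift hh' k') (hS' _ hz hzγ).1 (memFlow_tail hf' k') (hS' _ hz hzγ).2
    have hleU : ∀ i, h' (k' + i) ≤ S (h' k') i := fun i => by
      have := (hdeep (h' k') hz hzγ hzdeep).2 i
      rwa [← htail] at this
    exact gap_persist hL hb hy hh hf hh' hle hk'1 hU hfU hUle hleU l
  -- the pin reads, loads and couplings of the tower
  set ρ : ℕ → ℝ := fun i => L (a i) * (h (a i) - h' (a i)) with hρ_def
  set x : ℕ → ℝ := fun i => (a i : ℝ) * L (a i) * h (a i) ^ 3 / 2 with hx_def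
  set w : ℕ → ℕ → ℝ := fun i i' => ((a i' : ℝ) / ((a i' : ℝ) + a i)) ^ 2 with hw_def
  have hρ0 : ∀ i, 0 ≤ ρ i := fun i => mul_nonneg (hL _) (hg0 _)
  have hw0 : ∀ i i', 0 ≤ w i i' := fun i i' => by positivity
  have hinj := tower_injOn ha1 hsep
  have himg : (range n).image a ⊆ range K := fun k hk => by
    obtain ⟨i, hi, rfl⟩ := mem_image.mp hk; exact mem_range.mpr (haK i (mem_range.mp hi))
  -- (3) the drop read at scale l+1 re-reads every pin read, damped
  have hddlow : ∀ l : ℕ, ∑ i' ∈ range n, ((a i' : ℝ) / ((a i' : ℝ) + (l + 1))) ^ 2 * ρ i' ≤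
      ∑ k ∈ range K, L k * (h (l + 1 + k) - h' (l + 1 + k)) := by
    intro l
    calc ∑ i' ∈ range n, ((a i' : ℝ) / ((a i' : ℝ) + (l + 1))) ^ 2 * ρ i'
        ≤ ∑ i' ∈ range n, L (a i') * (h (l + 1 + a i') - h' (l + 1 + a i')) := sum_le_sum fun i' hi' => by
          have hp := hpers i' (mem_range.mp hi') (l + 1)
          rw [show a i' + (l + 1) = l + 1 + a i' by omega] at hp
          push_cast at hp
          calc ((a i' : ℝ) / ((a i' : ℝ) + (l + 1))) ^ 2 * ρ i' = L (a i') * (((a i' : ℝ) / ((a i' : ℝ) + (l + 1))) ^ 2 * (h (a i') - h' (a i'))) := by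
                simp only [hρ_def]; ring
            _ ≤ L (a i') * (h (l + 1 + a i') - h' (l + 1 + a i')) := mul_le_mul_of_nonneg_left hp (hL _)
      _ = ∑ k ∈ (range n).image a, L k * (h (l + 1 + k) - h' (l + 1 + k)) :=
          (sum_image (f := fun k => L k * (h (l + 1 + k) - h' (l + 1 + k))) hinj).symm
      _ ≤ ∑ k ∈ range K, L k * (h (l + 1 + k) - h' (l + 1 + k)) :=
          sum_le_sum_of_subset_of_nonneg himg fun k _ _ => mul_nonneg (hL k) (hg0 _)
  -- (4) the raw system: ρ_i ≤ x_i (η − Σ_{i'<n} w i i' ρ_{i'})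
  have hraw : ∀ i < n, ρ i ≤ x i * (η - ∑ i' ∈ range n, w i i' * ρ i') := by
    intro i hi
    set j := a i with hj_def
    have hj1 : 1 ≤ j := ha1 i hi
    have hjr : (0 : ℝ) < j := by exact_mod_cast hj1
    -- gap ≤ (h_j³/2)·δ_j
    have hδ0 : 0 ≤ 1 / h' j ^ 2 - 1 / h j ^ 2 :=
      sub_nonneg.mpr (one_div_le_one_div_of_le (pow_pos (hh' j).1 2) (pow_le_pow_left₀ (hh' j).1.le (hle j) 2))
    have hgap : h j - h' j ≤ h j ^ 3 / 2 * (1 / h' j ^ 2 - 1 / h j ^ 2) := by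
      have hwc := abs_sub_le_half_cube_mul (hh j).1 (hh' j).1 le_rfl (hle j)
      rwa [abs_of_nonneg (hg0 j), abs_sub_comm, abs_of_nonneg hδ0] at hwc
    -- the drops read at scales 1..j are at least j·Σ w ρ
    have hdrops : (j : ℝ) * ∑ i' ∈ range n, w i i' * ρ i' ≤ ∑ l ∈ range j, ∑ k ∈ range K, L k * (h (l + 1 + k) - h' (l + 1 + k)) := by
      have hl : ∀ l ∈ range j, ∑ i' ∈ range n, w i i' * ρ i' ≤ ∑ k ∈ range K, L k * (h (l + 1 + k) - h' (l + 1 + k)) := by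
        intro l hl
        have hlj : l + 1 ≤ j := mem_range.mp hl
        refine (sum_le_sum fun i' _ => ?_).trans (hddlow l)
        refine mul_le_mul_of_nonneg_right ?_ (hρ0 i')
        have ha' : (0 : ℝ) ≤ a i' := Nat.cast_nonneg _
        have hlj' : ((l : ℝ) + 1) ≤ j := by exact_mod_cast hlj
        simp only [hw_def]
        apply pow_le_pow_left₀ (by positivity)
        exact div_le_div_of_nonneg_left ha' (by positivity) (by rw [hj_def] at hlj'; linarith)
      have := sum_le_sum hl
      rwa [sum_const, card_range, nsmul_eq_mul] at this
    have hxw : 0 ≤ L j * (h j ^ 3 / 2) := mul_nonneg (hL j) (by have := (hh j).1; positivity)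
    calc ρ i = L j * (h j - h' j) := rfl
      _ ≤ L j * (h j ^ 3 / 2 * (1 / h' j ^ 2 - 1 / h j ^ 2)) := mul_le_mul_of_nonneg_left hgap (hL j)
      _ = L j * (h j ^ 3 / 2) * (1 / h' j ^ 2 - 1 / h j ^ 2) := by ring
      _ ≤ L j * (h j ^ 3 / 2) * ((j : ℝ) * η - (j : ℝ) * ∑ i' ∈ range n, w i i' * ρ i') :=
          mul_le_mul_of_nonneg_left (by linarith [hlev j, hdrops]) hxw
      _ = x i * (η - ∑ i' ∈ range n, w i i' * ρ i') := by simp only [hx_def]; ring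
  -- (5) the loads are at most √2/2
  have hx0 : ∀ i < n, 0 ≤ x i := fun i _ => by
    simp only [hx_def]; have := (hh (a i)).1; have := hL (a i); positivity
  have hxle : ∀ i < n, x i ≤ Real.sqrt 2 / 2 := by
    intro i hi
    have hjK : a i ∈ range K := mem_range.mpr (haK i hi)
    have h1 := weight_le_profile hmono hL hb hlo hdom hy hh hf hjK
    have h2 := ratio_le_sqrt_two (K := K) hL (ha1 i hi) hjK
    simp only [hx_def]
    linarith [h1.trans h2]
  -- (6) the system in (E64b)'s form, with ε i i' = 1 − w i i'
  have hsys : ∀ i < n, ρ i * (1 + x i / 4) ≤ x i * (η - ∑ i' ∈ range i, (1 - (1 - w i i')) * ρ i') := by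
    intro i hi
    have hsub : insert i (range i) ⊆ range n := by
      intro i' hi'
      rcases mem_insert.mp hi' with rfl | h'
      · exact mem_range.mpr hi
      · exact mem_range.mpr ((mem_range.mp h').trans hi)
    have hpart : w i i * ρ i + ∑ i' ∈ range i, w i i' * ρ i' ≤ ∑ i' ∈ range n, w i i' * ρ i' := by
      have := sum_le_sum_of_subset_of_nonneg hsub (f := fun i' => w i i' * ρ i')
        (fun i' _ _ => mul_nonneg (hw0 i i') (hρ0 i'))
      rwa [sum_insert (notMem_range_self)] at this
    have hwii : w i i = 1 / 4 := by
      have : (0 : ℝ) < a i := by exact_mod_cast ha1 i hi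
      simp only [hw_def]; field_simp; ring
    rw [hwii] at hpart
    have := hraw i hi
    have hxi := hx0 i hi
    have : ρ i ≤ x i * (η - (1 / 4 * ρ i + ∑ i' ∈ range i, w i i' * ρ i')) :=
      this.trans (mul_le_mul_of_nonneg_left (by linarith) hxi)
    have e : ∑ i' ∈ range i, (1 - (1 - w i i')) * ρ i' = ∑ i' ∈ range i, w i i' * ρ i' := sum_congr rfl fun i' _ => by ring
    rw [e]; nlinarith
  -- (7) the coupling defects: 1 − w i i' ≤ 2·(a i / a i') ≤ 2·30^{−(i−i')}
  have hε : ∀ i < n, ∀ i' < i, 1 - w i i' ≤ 2 * (1 / 30) ^ (i - i') := by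
    intro i hi i' hi'i
    have hai : (0 : ℝ) < a i := by exact_mod_cast ha1 i hi
    have hai' : (0 : ℝ) < a i' := by exact_mod_cast ha1 i' (hi'i.trans hi)
    have h1 : 1 - w i i' ≤ 2 * ((a i : ℝ) / a i') := by
      have := one_sub_two_mul_div_le_sq hai.le hai'
      simp only [hw_def]; linarith
    -- the separation chain: 30^{i-i'}·a i ≤ a i'
    obtain ⟨d, hd⟩ := Nat.exists_eq_add_of_lt hi'i
    have hdi : i = i' + (d + 1) := by omega
    have hc := tower_chain hsep (d + 1) i' (by rw [← hdi]; exact hi)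
    rw [← hdi] at hc
    have hcr : (30 : ℝ) ^ (i - i') * a i ≤ a i' := by
      rw [show i - i' = d + 1 by omega]; exact_mod_cast hc
    have h2 : (a i : ℝ) / a i' ≤ (1 / 30) ^ (i - i') := by
      rw [div_le_iff₀ hai', one_div_pow, one_div_mul_eq_div, le_div_iff₀ (by positivity)]
      linarith
    linarith
  -- (8) close the system
  have hclose := sum_le_of_slack_system (ε := fun i i' => 1 - w i i') hη0 hx0 hxle (fun i _ => hρ0 i) hε hsys
  -- (9) the drop at the pin is the sum of the pin reads
  have hdrop : B h - B h' = ∑ i ∈ range n, ρ i := by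
    have e0 : B h - B h' = ∑ k ∈ range K, L k * (h k - h' k) := by
      simp only [hB_def]; rw [add_sub_add_left_eq_sub, ← sum_sub_distrib]; exact sum_congr rfl fun k _ => by ring
    have e1 : ∑ i ∈ range n, ρ i = ∑ k ∈ (range n).image a, L k * (h k - h' k) := by
      simp only [hρ_def]; exact (sum_image (f := fun k => L k * (h k - h' k)) hinj).symm
    rw [e0, e1]
    refine (sum_subset himg fun k hk hkn => ?_).symm
    rcases Nat.eq_zero_or_pos k with rfl | hkpos
    · rw [hf.1, hf'.1]; ring
    · have hne : ∀ i < n, k ≠ a i := fun i hi heq => hkn (mem_image.mpr ⟨i, mem_range.mpr hi, heq.symm⟩)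
      rw [hsupp k hk hkpos.ne' hne]; ring
  have : B h - B h' ≤ η := by rw [hdrop]; exact hclose
  show B h ≤ B' h'
  rw [hη_def] at this; linarith

/-! ## §3 END: every tower with consecutive ratios `≥ 30` compares at any size, whatever its height -/

/-- **EVERY TOWER WITH CONSECUTIVE RATIOS AT LEAST `30` COMPARES AT ANY SIZE — UNIFORMLY IN THE HEIGHT, WITH A MARKOV RIDER.**  `B(u) = b + Σ_{k<K} L_k·u_k`
on ]0,γ] with `b > 0`, `L ≥ 0` supported on `{0} ∪ {a_0, …, a_{n−1}}`, ages `1 ≤ a_i < K` with **`30·a_{i+1} ≤ a_i`** — the height `n`, the sizes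
`L_{a_i}` AND the Markov weight `L_0` ARBITRARY; `B′` with zeroth moment `M′ ≥ 0`, `B ≤ B′` on the box, the EXCESS `B′ − B` ISOTONE; `h`, `h′` ANY box
solutions of `B`, `B′` from one pin `p ∈ ]0,γ]`.  Then `h′ ≤ h` at EVERY scale ((E63a) `le_of_isotone_excess_of_step_below` with the STEP of §2).
(E63c) needed ratios `36 ∕ 165 ∕ 704 ∕ 2896 ∕ …` growing with the height; here ONE ratio serves every height. [folklore] -/
theorem le_of_isotone_excess_tower_slack {p : ℝ} (hL : ∀ k, 0 ≤ L k) (hb : 0 < b)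
    (ha1 : ∀ i < n, 1 ≤ a i) (haK : ∀ i < n, a i < K) (hsep : ∀ i, i + 1 < n → 30 * a (i + 1) ≤ a i)
    (hsupp : ∀ k ∈ range K, k ≠ 0 → (∀ i < n, k ≠ a i) → L k = 0)
    (hB' : ∀ u u' : ℕ → ℝ, SeqBox γ u → SeqBox γ u' → ∀ D : ℝ, (∀ j, |u j - u' j| ≤ D) → |B' u - B' u'| ≤ M' * D) (hM' : 0 ≤ M')
    (hexc : ∀ u, SeqBox γ u → (fun u : ℕ → ℝ => b + ∑ k ∈ range K, L k * u k) u ≤ B' u)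
    (hDmono : ∀ u v : ℕ → ℝ, SeqBox γ u → SeqBox γ v → (∀ j, u j ≤ v j) →
      B' u - (fun u : ℕ → ℝ => b + ∑ k ∈ range K, L k * u k) u ≤ B' v - (fun u : ℕ → ℝ => b + ∑ k ∈ range K, L k * u k) v)
    (hp : 0 < p) (hpγ : p ≤ γ) (hh : SeqBox γ h) (hf : MemFlow (fun u : ℕ → ℝ => b + ∑ k ∈ range K, L k * u k) p h)
    (hh' : SeqBox γ h') (hf' : MemFlow B' p h') (j : ℕ) : h' j ≤ h j :=
  le_of_isotone_excess_of_step_below (B := fun u : ℕ → ℝ => b + ∑ k ∈ range K, L k * u k) (affine_monotone hL)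
    (affine_zerothMoment hL) (sum_nonneg fun k _ => hL k) hb (affine_floor hL) hB' hM' hexc hDmono
    (fun _ _ hS huniq hS' huniq' _ hy hyγ hdeep _ _ hu hfu hu' hfu' hle =>
      effective_le_of_family_le_at_tower_slack hL hb ha1 haK hsep hsupp hexc hDmono hS huniq hS' huniq' hy hyγ hdeep hu hfu hu' hfu' hle)
    hp hpγ hh hf hh' hf' j

end Summit.QuantumFields.BalabanUV.Beta.EriceRemainderEnclosureHistoryAutonomyComparisonTowerSlack

end
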